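import Mathlib.MeasureTheory.Measure.Hausdorff
import Mathlib.MeasureTheory.Function.LpSeminorm.Basic
import Mathlib.Analysis.SpecialFunctions.Pow.Real
import Literature.Analysis.FunctionSpaces.SobolevDomain
import Literature.Analysis.FluidPDE.VectorCalculus
import Literature.Analysis.FluidPDE.ClassicalSolution
import Literature.Analysis.FluidPDE.WeakSolution
import HarnessLib

-- provenance: harness21/H21/H21/Prelude/FluidKinetic/SuitableWeak.lean @ 95cd6fb (interim HEAD d8f2665); M5 mechanical rewrite
/-!
# Suitable weak solutions, parabolic Hausdorff measure, regular and singular points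

Trunk: FluidKinetic (outline `H21/Outlines/FluidKinetic.md`, item F9 `SuitableWeak`; notions
`suitable_weak_solution`, `parabolic_hausdorff_measure`, `regular_singular_points`).

Let `E` be a finite-dimensional real inner product space (physical space, `ℝ³` in
Caffarelli–Kohn–Nirenberg) with Lebesgue measure `volume`, and let `Q : Opens (ℝ × E)` be an open
space–time region. This file provides

* the backward parabolic cylinders `Q_r(t, x) = (t - r², t) × B_r(x)` (`Fluid.parabolicCylinder`)
  and the centred ones `Q*_r(t, x) = (t - r², t + r²) × B_r(x)` (`Fluid.parabolicCylinderCentered`)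
  of CKN 1982, (2.6) and §6, together with their `Opens` versions;
* weak *spatial* gradients of time-dependent fields on `Q` (`Fluid.HasWeakSpatialGradientOn`),
  tested against the accepted space–time test functions `Fluid.IsSpaceTimeTestOn Q`
  (= `Literature.IsTestFunctionOn Q ∘ uncurry`, G03 `SobolevDomain`);
* **suitable weak solutions** (`Fluid.IsSuitableWeakSolutionOn Q ν f u p`, CKN 1982, (2.1)–(2.5);
  Lin 1998, Def. 1): a distributional solution `(u, p)` on `Q` with `u ∈ L^∞_t L²_x`,
  `∇u ∈ L²`, `p ∈ L^{3/2}` locally, satisfying the local (generalized) energy inequality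
  `2ν ∫∫ |∇u|² φ ≤ ∫∫ (|u|² (φₜ + νΔφ) + (|u|² + 2p) u·∇φ + 2 (f·u) φ)` for all `φ ≥ 0` in
  `C_c^∞(Q)`;
* the CKN / Albritton–Barker scaled quantities `A, E, C, D` (`Fluid.cknA`, `cknE`, `cknC`, `cknD`),
  all `ℝ≥0∞`-valued (`∫⁻`, `⨆` in `ℝ≥0∞`);
* regular points (`Fluid.IsRegularPoint`: `u` essentially bounded on some `Q*_r(z)`), the
  singular set, singular times and Type I / Type II blow-up (Seregin 2012, §1);
* the parabolic Hausdorff (pre)measure `𝒫^s` of CKN (2.6) built from countable covers by centred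
  parabolic cylinders (`Fluid.parabolicHausdorffContent`, `Fluid.parabolicHausdorff`,
  `Fluid.IsParabolicNull`).

## Mathlib search

Mathlib (this pin) has `Metric.ball`, `Set.Ioo`, `eLpNorm`, `tsum`, `MeasureTheory.Measure.hausdorffMeasure`
(`μH[s]`, for the *Euclidean* metric; used elsewhere for singular times) and
`OuterMeasure.mkMetric`, but no parabolic metric / parabolic Hausdorff measure, no Navier–Stokes
notions (`suitable`, `parabolic cylinder`, `Caffarelli`: no hits outside `Matrix.IsParabolic`).
Following the outline (§4.4) we do **not** introduce a parabolic-metric type synonym on `ℝ × E`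
(which would let us reuse `μH[s]`); instead `𝒫^s` is defined directly by cylinder covers exactly
as in CKN (2.6), in the style of `OuterMeasure.mkMetric'.pre` / `iSup` over `δ`.

## Design notes

* All domains are `Q : Opens (ℝ × E)`; there are no `isOpen` fields.
* Integrals in the weak-gradient identity and in the local energy inequality are iterated
  Bochner integrals `∫ t, ∫ x, …` over `ℝ × E`; the integrands are compactly supported inside `Q`
  (they contain a test function as a factor), so this agrees with `∫∫_Q`. (The accepted
  `IsDistributionalNSSolutionOn` writes `∫ z in Q` for the product measure; both are the H21
  "junk `0` if not integrable" Bochner convention, and a later pass may uniformise.)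
* `cknA`, `cknE`, `cknC`, `cknD` are meant for `r > 0`; for `r ≤ 0`, `(ENNReal.ofReal r)⁻¹ = ∞`
  (documented junk value). Being `ℝ≥0∞`-valued, suprema such as `⨆ r, cknA r z u + …` carry no
  real-`sSup` junk, so finiteness statements `⨆ … < ∞` are honest.
* `parabolicHausdorffContent s δ` allows radius `0` (the empty cylinder), as Mathlib's `mkMetric`
  allows empty sets in covers, so finite covers are admissible. Only `s > 0` is meaningful (CKN
  uses `s = 1`): for `s = 0`, `Real.rpow 0 0 = 1` turns `𝒫⁰` into a counting-type content, and
  `parabolicHausdorff_empty` is stated for `0 < s`. For `E` empty there are no cover centres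
  `ℕ → ℝ × E`, so `𝒫^s_δ X = ∞` for every `X` (junk); the outer-measure properties
  `parabolicHausdorff_empty` and `parabolicHausdorff_le_mul_hausdorffMeasure` therefore assume
  `[Nonempty E]`.
* `cknA` takes a genuine `⨆` over `t` (not `ess sup`), as the outline prescribes; for a
  non-normalised representative of `u` this is slightly stronger than CKN's `A`.
* `IsTypeIBlowup u T` does not itself require `T` to be a singular time (a bounded `u` satisfies
  the Type I bound at every `T`); `IsTypeIIBlowup` conjoins `IsSingularTime`.
* `IsRegularPoint u z` is Hölder/`L^∞` regularity in the weakest customary form: `u` is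
  essentially bounded on some centred cylinder `Q*_r(z)` (CKN 1982, §6: "regular points are those
  with `u ∈ L^∞` in a neighbourhood"; Seregin 2012, §1).

## References

* L. Caffarelli, R. Kohn, L. Nirenberg, *Partial regularity of suitable weak solutions of the
  Navier–Stokes equations*, CPAM 35 (1982), §2 (2.1)–(2.6), §6.
* F. Lin, *A new proof of the Caffarelli–Kohn–Nirenberg theorem*, CPAM 51 (1998), Def. 1.
* G. Seregin, *A certain necessary condition of potential blow up for Navier–Stokes equations*,
  Comm. Math. Phys. 312 (2012), §1.
* D. Albritton, T. Barker, *Global weak Besov solutions of the Navier–Stokes equations and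
  applications*, Arch. Ration. Mech. Anal. 232 (2019), (1.6).
-/

noncomputable section

open MeasureTheory TopologicalSpace Set Function Metric Filter
open scoped Laplacian InnerProductSpace RealInnerProductSpace ENNReal NNReal Topology

namespace Literature.Analysis.FluidPDE

/-! ### Parabolic cylinders -/

section Cylinder

variable {E : Type*} [PseudoMetricSpace E]

/-- The (backward) **parabolic cylinder** `Q_r(t, x) = (t - r², t) × B_r(x) ⊆ ℝ × E` centred at
the space–time point `z = (t, x)` (Caffarelli–Kohn–Nirenberg 1982, §2, before (2.6):
`Q_r(x,t) = {(y, τ) : |y - x| < r, t - r² < τ < t}`). Empty for `r ≤ 0`. [cite: CaffarelliKohnNirenberg1982, §2  before (2.6] -/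
def parabolicCylinder (r : ℝ) (z : ℝ × E) : Set (ℝ × E) :=
  Ioo (z.1 - r ^ 2) z.1 ×ˢ ball z.2 r

/-- The **centred parabolic cylinder** `Q*_r(t, x) = (t - r², t + r²) × B_r(x) ⊆ ℝ × E`
(Caffarelli–Kohn–Nirenberg 1982, §2, (2.6) and §6: the cylinders `Q*` used to define the
parabolic Hausdorff measure and regular points). Empty for `r ≤ 0`. [cite: CaffarelliKohnNirenberg1982, §2  (2.6] -/
def parabolicCylinderCentered (r : ℝ) (z : ℝ × E) : Set (ℝ × E) :=
  Ioo (z.1 - r ^ 2) (z.1 + r ^ 2) ×ˢ ball z.2 r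

/-- Membership in the backward parabolic cylinder (CKN 1982, §2). [cite: CKN1982, §2] -/
@[simp]
theorem mem_parabolicCylinder {r : ℝ} {z w : ℝ × E} :
    w ∈ parabolicCylinder r z ↔ (z.1 - r ^ 2 < w.1 ∧ w.1 < z.1) ∧ dist w.2 z.2 < r := by
  simp [parabolicCylinder, mem_prod, mem_Ioo, mem_ball]

/-- Membership in the centred parabolic cylinder (CKN 1982, (2.6)). [cite: CKN1982, (2.6] -/
@[simp]
theorem mem_parabolicCylinderCentered {r : ℝ} {z w : ℝ × E} :
    w ∈ parabolicCylinderCentered r z ↔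
      (z.1 - r ^ 2 < w.1 ∧ w.1 < z.1 + r ^ 2) ∧ dist w.2 z.2 < r := by
  simp [parabolicCylinderCentered, mem_prod, mem_Ioo, mem_ball]

/-- Parabolic cylinders are open (product of an open interval and an open ball). [folklore] -/
theorem isOpen_parabolicCylinder (r : ℝ) (z : ℝ × E) : IsOpen (parabolicCylinder r z) :=
  isOpen_Ioo.prod isOpen_ball

/-- Centred parabolic cylinders are open. [folklore] -/
theorem isOpen_parabolicCylinderCentered (r : ℝ) (z : ℝ × E) :
    IsOpen (parabolicCylinderCentered r z) :=
  isOpen_Ioo.prod isOpen_ball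

/-- The backward parabolic cylinder as an element of `Opens (ℝ × E)` (CKN 1982, §2), so that it
can serve as the domain `Q` of `IsSuitableWeakSolutionOn`. [cite: CKN1982, §2] -/
def parabolicCylinderOpens (r : ℝ) (z : ℝ × E) : Opens (ℝ × E) :=
  ⟨parabolicCylinder r z, isOpen_parabolicCylinder r z⟩

/-- The centred parabolic cylinder as an element of `Opens (ℝ × E)` (CKN 1982, (2.6)). [cite: CKN1982, (2.6] -/
def parabolicCylinderCenteredOpens (r : ℝ) (z : ℝ × E) : Opens (ℝ × E) :=
  ⟨parabolicCylinderCentered r z, isOpen_parabolicCylinderCentered r z⟩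

/-- Underlying set of `parabolicCylinderOpens`. [folklore] -/
@[simp]
theorem coe_parabolicCylinderOpens (r : ℝ) (z : ℝ × E) :
    ((parabolicCylinderOpens r z : Opens (ℝ × E)) : Set (ℝ × E)) = parabolicCylinder r z :=
  rfl

/-- Underlying set of `parabolicCylinderCenteredOpens`. [folklore] -/
@[simp]
theorem coe_parabolicCylinderCenteredOpens (r : ℝ) (z : ℝ × E) :
    ((parabolicCylinderCenteredOpens r z : Opens (ℝ × E)) : Set (ℝ × E)) =
      parabolicCylinderCentered r z :=
  rfl

/-- The backward cylinder is contained in the centred one, `Q_r(z) ⊆ Q*_r(z)` (CKN 1982, §2). [cite: CKN1982, §2] -/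
theorem parabolicCylinder_subset_centered (r : ℝ) (z : ℝ × E) :
    parabolicCylinder r z ⊆ parabolicCylinderCentered r z :=
  prod_mono (Ioo_subset_Ioo_right (by nlinarith [sq_nonneg r])) Subset.rfl

/-- For `r ≤ 0` the parabolic cylinder is empty (the ball is). [folklore] -/
theorem parabolicCylinder_eq_empty {r : ℝ} (hr : r ≤ 0) (z : ℝ × E) :
    parabolicCylinder r z = ∅ := by
  simp [parabolicCylinder, ball_eq_empty.2 hr]

/-- For `r ≤ 0` the centred parabolic cylinder is empty (the ball is). [folklore] -/
theorem parabolicCylinderCentered_eq_empty {r : ℝ} (hr : r ≤ 0) (z : ℝ × E) :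
    parabolicCylinderCentered r z = ∅ := by
  simp [parabolicCylinderCentered, ball_eq_empty.2 hr]

/-- Centred parabolic cylinders are monotone in the radius for `0 ≤ r ≤ r'`. [folklore] -/
theorem parabolicCylinderCentered_mono {r r' : ℝ} (hr : 0 ≤ r) (h : r ≤ r') (z : ℝ × E) :
    parabolicCylinderCentered r z ⊆ parabolicCylinderCentered r' z := by
  have h2 : r ^ 2 ≤ r' ^ 2 := pow_le_pow_left₀ hr h 2
  exact prod_mono (Ioo_subset_Ioo (by linarith) (by linarith)) (ball_subset_ball h)

end Cylinder

/-! ### Weak spatial gradients and suitable weak solutions -/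

section Suitable

variable {E : Type*} [NormedAddCommGroup E] [InnerProductSpace ℝ E] [FiniteDimensional ℝ E]
  [MeasurableSpace E] [BorelSpace E]

/-- **Weak spatial gradient on a space–time region.** `G : ℝ → E → E →L[ℝ] E` is a weak gradient
*in the space variables* of the time-dependent field `u : ℝ → E → E` on the open set
`Q ⊆ ℝ × E`: `u` and `G` are locally integrable on `Q` and, for every real space–time test
function `φ ∈ C_c^∞(Q)` and all directions `v, w ∈ E`,
`∫∫ (∂_v φ) ⟪u, w⟫ dx dt = -∫∫ φ ⟪G v, w⟫ dx dt`
(Caffarelli–Kohn–Nirenberg 1982, (2.1): `∇u ∈ L²(Q)` in the sense of distributions; Evans,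
*PDE*, §5.2.1). Space–time analogue of the accepted `Literature.Analysis.FunctionSpaces.HasWeakFDerivOn` with derivatives in
`x` only; the integrals are iterated over `ℝ × E` (integrands are supported in `Q`). [cite: CaffarelliKohnNirenberg1982, (2.1] -/
structure HasWeakSpatialGradientOn (Q : Opens (ℝ × E)) (u : ℝ → E → E)
    (G : ℝ → E → E →L[ℝ] E) : Prop where
  /-- The field is locally integrable on `Q`. -/
  locallyIntegrableOn : LocallyIntegrableOn (uncurry u) (Q : Set (ℝ × E)) volume
  /-- The weak spatial gradient is locally integrable on `Q`. -/
  locallyIntegrableOn_grad : LocallyIntegrableOn (uncurry G) (Q : Set (ℝ × E)) volume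
  /-- Integration by parts in space against space–time test functions. -/
  integral_fderiv_mul_inner_eq : ∀ φ : ℝ → E → ℝ, IsSpaceTimeTestOn Q φ → ∀ v w : E,
    ∫ t, ∫ x, fderiv ℝ (φ t) x v * ⟪u t x, w⟫ = -∫ t, ∫ x, φ t x * ⟪G t x v, w⟫

/-- **Suitable weak solutions** of the forced Navier–Stokes system
`∂ₜu + (u·∇)u + ∇p = νΔu + f`, `div u = 0` on an open space–time region `Q ⊆ ℝ × E`
(Caffarelli–Kohn–Nirenberg 1982, §2, (2.1)–(2.5); Lin 1998, Def. 1): `(u, p)` is a distributional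
solution on `Q` (`IsDistributionalNSSolutionOn`), `u ∈ L^∞_t L²_x` and `∇u ∈ L²_{t,x}` locally
on `Q` ((2.1)), `p ∈ L^{3/2}_loc(Q)` ((2.3) in Lin's form), and the **local energy inequality**
(2.5) holds for every nonnegative `φ ∈ C_c^∞(Q)`:
`2ν ∫∫ |∇u|² φ ≤ ∫∫ (|u|² (φₜ + νΔφ) + (|u|² + 2p) u·∇φ + 2 (f·u) φ)`. [cite: CaffarelliKohnNirenberg1982, §2  (2.1] -/
structure IsSuitableWeakSolutionOn (Q : Opens (ℝ × E)) (ν : ℝ) (f u : ℝ → E → E)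
    (p : ℝ → E → ℝ) : Prop where
  /-- `(u, p)` solves Navier–Stokes in the sense of distributions on `Q` (CKN (2.2), (2.4)). -/
  distributional : IsDistributionalNSSolutionOn Q ν f u p
  /-- `u ∈ L^∞_t L²_x` locally: on every compact `K ⊆ Q` the spatial `L²` norms of `u` are
  essentially bounded in time (CKN (2.1), first half). -/
  energyClass : ∀ K ⊆ (Q : Set (ℝ × E)), IsCompact K → ∃ C : ℝ≥0, ∀ᵐ t : ℝ,
    ∫⁻ x, K.indicator (fun z : ℝ × E => ‖u z.1 z.2‖ₑ ^ 2) (t, x) ≤ C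
  /-- `p ∈ L^{3/2}_loc(Q)` (Lin 1998, Def. 1; CKN (2.3) has `L^{5/4}`, cf. their §1 remarks). -/
  pressure : ∀ K ⊆ (Q : Set (ℝ × E)), IsCompact K →
    ∫⁻ z in K, ‖p z.1 z.2‖ₑ ^ (3 / 2 : ℝ) < ∞
  /-- Three components bundled under one existential: (i) `u` has a weak spatial gradient `G`
  on `Q`; (ii) `G ∈ L²_loc(Q)`, i.e. `∇u ∈ L²_loc` (CKN (2.1), second half); (iii) the local
  energy inequality (CKN (2.5)) for every nonnegative test function `φ ∈ C_c^∞(Q)`, written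
  with this `G` in place of `∇u`. -/
  localEnergy : ∃ G : ℝ → E → E →L[ℝ] E, HasWeakSpatialGradientOn Q u G ∧
    (∀ K ⊆ (Q : Set (ℝ × E)), IsCompact K →
      ∫⁻ z in K, ENNReal.ofReal (frobeniusNormSq (G z.1 z.2)) < ∞) ∧
    ∀ φ : ℝ → E → ℝ, IsSpaceTimeTestOn Q φ → (∀ t x, 0 ≤ φ t x) →
      2 * ν * ∫ t, ∫ x, frobeniusNormSq (G t x) * φ t x ≤
        ∫ t, ∫ x, (‖u t x‖ ^ 2 * (timeDeriv φ t x + ν * Δ (φ t) x) +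
          (‖u t x‖ ^ 2 + 2 * p t x) * ⟪u t x, gradient (φ t) x⟫ +
          2 * ⟪f t x, u t x⟫ * φ t x)

variable {Q Q' : Opens (ℝ × E)} {ν : ℝ} {f u : ℝ → E → E} {p : ℝ → E → ℝ}
  {G : ℝ → E → E →L[ℝ] E}

/-- Restriction of a weak spatial gradient to a smaller open region (test functions on `Q'` are
test functions on `Q`; Evans, *PDE*, §5.2.1). [folklore] -/
theorem HasWeakSpatialGradientOn.mono (h : HasWeakSpatialGradientOn Q u G) (hQ : Q' ≤ Q) :
    HasWeakSpatialGradientOn Q' u G where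
  locallyIntegrableOn := h.locallyIntegrableOn.mono_set hQ
  locallyIntegrableOn_grad := h.locallyIntegrableOn_grad.mono_set hQ
  integral_fderiv_mul_inner_eq φ hφ v w := h.integral_fderiv_mul_inner_eq φ (hφ.mono hQ) v w

/-- **Restriction of the domain**: a suitable weak solution on `Q` is a suitable weak solution on
every open `Q' ⊆ Q` (all conditions are local / tested against `C_c^∞(Q') ⊆ C_c^∞(Q)`;
Caffarelli–Kohn–Nirenberg 1982, §2). [cite: CaffarelliKohnNirenberg1982, §2] -/
def IsSuitableWeakSolutionOn.mono : Prop :=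
  ∀ (h : IsSuitableWeakSolutionOn Q ν f u p) (hQ : Q' ≤ Q),
    IsSuitableWeakSolutionOn Q' ν f u p

end Suitable

/-! ### The CKN / Albritton–Barker scaled quantities -/

section Scaled

variable {E : Type*} [NormedAddCommGroup E] [InnerProductSpace ℝ E] [FiniteDimensional ℝ E]
  [MeasurableSpace E] [BorelSpace E]

/-- The scaled energy quantity
`A(r) = A(r, z; u) = sup_{t - r² < s < t} r⁻¹ ∫_{B_r(x)} |u(s, y)|² dy ∈ [0, ∞]`, `z = (t, x)`
(Caffarelli–Kohn–Nirenberg 1982, §2 after (2.6) and Lemma 5.1 ff.; Albritton–Barker 2019, (1.6)).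
The supremum over `t` is a genuine `⨆` (`sup`, not `ess sup`); for a non-normalised
representative of `u` this is slightly stronger than CKN's `A`, as the outline prescribes.
Intended for `r > 0`; for `r ≤ 0`, `(ENNReal.ofReal r)⁻¹ = ∞` (junk). [cite: CaffarelliKohnNirenberg1982, §2 after (2.6] -/
def cknA (r : ℝ) (z : ℝ × E) (u : ℝ → E → E) : ℝ≥0∞ :=
  ⨆ t ∈ Ioo (z.1 - r ^ 2) z.1, (ENNReal.ofReal r)⁻¹ * ∫⁻ x in ball z.2 r, ‖u t x‖ₑ ^ 2

/-- The scaled dissipation `E(r) = r⁻¹ ∫∫_{Q_r(z)} |∇u|² ∈ [0, ∞]`, in terms of a (weak) spatial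
gradient `G` of `u` (Caffarelli–Kohn–Nirenberg 1982, §2, `δ(r)`; Albritton–Barker 2019, (1.6)).
Intended for `r > 0`; for `r ≤ 0`, `(ENNReal.ofReal r)⁻¹ = ∞` (junk). [cite: CaffarelliKohnNirenberg1982, §2   δ(r] -/
def cknE (r : ℝ) (z : ℝ × E) (G : ℝ → E → E →L[ℝ] E) : ℝ≥0∞ :=
  (ENNReal.ofReal r)⁻¹ *
    ∫⁻ q in parabolicCylinder r z, ENNReal.ofReal (frobeniusNormSq (G q.1 q.2))

/-- The scaled cubic quantity `C(r) = r⁻² ∫∫_{Q_r(z)} |u|³ ∈ [0, ∞]`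
(Caffarelli–Kohn–Nirenberg 1982, §2; Albritton–Barker 2019, (1.6)). Intended for `r > 0`;
for `r ≤ 0`, `(ENNReal.ofReal r ^ 2)⁻¹ = ∞` (junk). [cite: CaffarelliKohnNirenberg1982, §2] -/
def cknC (r : ℝ) (z : ℝ × E) (u : ℝ → E → E) : ℝ≥0∞ :=
  (ENNReal.ofReal r ^ 2)⁻¹ * ∫⁻ q in parabolicCylinder r z, ‖u q.1 q.2‖ₑ ^ (3 : ℕ)

/-- The scaled pressure quantity `D(r) = r⁻² ∫∫_{Q_r(z)} |p|^{3/2} ∈ [0, ∞]`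
(Lin 1998; Albritton–Barker 2019, (1.6); CKN 1982 use the `L^{5/4}` variant). Intended for
`r > 0`; for `r ≤ 0`, `(ENNReal.ofReal r ^ 2)⁻¹ = ∞` (junk). [cite: Lin1998] -/
def cknD (r : ℝ) (z : ℝ × E) (p : ℝ → E → ℝ) : ℝ≥0∞ :=
  (ENNReal.ofReal r ^ 2)⁻¹ * ∫⁻ q in parabolicCylinder r z, ‖p q.1 q.2‖ₑ ^ (3 / 2 : ℝ)

end Scaled

/-! ### Regular and singular points; Type I / Type II blow-up -/

section Regular

variable {E : Type*} [NormedAddCommGroup E]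

/-- **Type I blow-up** at time `T`: the self-similar rate `‖u(t, x)‖ ≤ C / √(T - t)` holds for
all `x` and all `t < T` close to `T` (Leray 1934; Seregin 2012, §1, (1.4)). This predicate does
not itself require `T` to be a singular time (a bounded `u` satisfies it at every `T`); it is
only used conjoined with `IsSingularTime`, cf. `IsTypeIIBlowup`. [cite: Leray1934] -/
def IsTypeIBlowup (u : ℝ → E → E) (T : ℝ) : Prop :=
  ∃ C : ℝ, ∀ᶠ t in 𝓝[<] T, ∀ x, ‖u t x‖ ≤ C / Real.sqrt (T - t)

variable [MeasureSpace E]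

/-- **Regular points.** The space–time point `z = (t, x)` is a *regular point* of the field
`u : ℝ → E → E` if `u` is essentially bounded on some centred parabolic cylinder `Q*_r(z)`,
`r > 0` (Caffarelli–Kohn–Nirenberg 1982, §6: "a point is regular if `u` is `L^∞` in a
neighbourhood"; Seregin 2012, §1). All other points are *singular*. The measure on `ℝ × E` is
the product `volume`. [cite: CaffarelliKohnNirenberg1982, §6: "a point is regular if  u  is  L^∞] -/
def IsRegularPoint (u : ℝ → E → E) (z : ℝ × E) : Prop :=
  ∃ r > 0, eLpNorm (uncurry u) ∞ (volume.restrict (parabolicCylinderCentered r z)) < ∞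

/-- The **singular set** `S = {z ∈ Q | z is not a regular point of u}` of `u` in a space–time
region `Q ⊆ ℝ × E` (Caffarelli–Kohn–Nirenberg 1982, §6, Theorem B; use `↑Q` for `Q : Opens`). [cite: CaffarelliKohnNirenberg1982, §6  Theorem B] -/
def singularSet (u : ℝ → E → E) (Q : Set (ℝ × E)) : Set (ℝ × E) :=
  {z ∈ Q | ¬ IsRegularPoint u z}

/-- `T` is a **singular (blow-up) time** of `u` if some point `(T, x)` is singular
(Seregin 2012, §1). [cite: Seregin2012, §1] -/
def IsSingularTime (u : ℝ → E → E) (T : ℝ) : Prop :=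
  ∃ x, ¬ IsRegularPoint u (T, x)

/-- **Type II blow-up** at time `T`: `T` is a singular time and the blow-up is not of Type I
(Seregin 2012, §1). [cite: Seregin2012, §1] -/
def IsTypeIIBlowup (u : ℝ → E → E) (T : ℝ) : Prop :=
  IsSingularTime u T ∧ ¬ IsTypeIBlowup u T

variable {u : ℝ → E → E}

/-- Membership in the singular set (CKN 1982, §6). [cite: CKN1982, §6] -/
@[simp]
theorem mem_singularSet {Q : Set (ℝ × E)} {z : ℝ × E} :
    z ∈ singularSet u Q ↔ z ∈ Q ∧ ¬ IsRegularPoint u z :=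
  Iff.rfl

/-- The singular set is contained in the region. [folklore] -/
theorem singularSet_subset (Q : Set (ℝ × E)) : singularSet u Q ⊆ Q :=
  fun _ hz => hz.1

/-- The singular set is monotone in the region. [folklore] -/
theorem singularSet_mono {Q Q' : Set (ℝ × E)} (h : Q ⊆ Q') : singularSet u Q ⊆ singularSet u Q' :=
  fun _ hz => ⟨h hz.1, hz.2⟩

/-- **The regular set is open**: if `u ∈ L^∞(Q*_r(z))` then every point of `Q*_r(z)` has a
smaller centred cylinder inside `Q*_r(z)` (Caffarelli–Kohn–Nirenberg 1982, §6: the singular set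
is relatively closed). Stated globally on `ℝ × E`; the version relative to a region `Q` is
`singularSet_eq_inter_compl`. [cite: CaffarelliKohnNirenberg1982, §6: the singular set is relatively close] -/
def isOpen_setOf_isRegularPoint : Prop :=
  ∀ (u : ℝ → E → E),
    IsOpen {z : ℝ × E | IsRegularPoint u z}

/-- Consequently the singular set of `u` in `Q` is relatively closed: it is `Q ∩ (regular set)ᶜ`
(CKN 1982, §6). [cite: CKN1982, §6] -/
theorem singularSet_eq_inter_compl (Q : Set (ℝ × E)) :
    singularSet u Q = Q ∩ {z : ℝ × E | IsRegularPoint u z}ᶜ :=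
  rfl

end Regular

section RegularClassical

variable {E : Type*} [NormedAddCommGroup E] [InnerProductSpace ℝ E] [FiniteDimensional ℝ E]
  [MeasurableSpace E] [BorelSpace E]

/-- **Smooth solutions have no singular points in the interior of their time set**: if `(u, p)`
is a classical solution on `S × E` and `t ∈ interior S`, then `(t, x)` is a regular point of `u`
for every `x` (a continuous function is bounded on the compact closure of a small cylinder
`Q*_r(t, x) ⊆ S × E`; CKN 1982, §6). [cite: CKN1982, §6] -/
def IsClassicalNSSolutionOn.isRegularPoint : Prop :=
  ∀ {S : Set ℝ} {ν : ℝ} {f u : ℝ → E → E} {p : ℝ → E → ℝ} (h : IsClassicalNSSolutionOn S ν f u p) {t : ℝ} (ht : t ∈ interior S) (x : E),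
    IsRegularPoint u (t, x)

end RegularClassical

/-! ### The parabolic Hausdorff measure `𝒫^s` -/

section Hausdorff

variable {E : Type*} [PseudoMetricSpace E]

/-- The **parabolic Hausdorff `δ`-content** `𝒫^s_δ(X) = inf { ∑ᵢ rᵢ^s : X ⊆ ⋃ᵢ Q*_{rᵢ}(zᵢ),
0 ≤ rᵢ < δ }` of a set `X ⊆ ℝ × E`, the infimum being over countable covers by centred parabolic
cylinders (Caffarelli–Kohn–Nirenberg 1982, (2.6)). Radius `0` (the empty cylinder) is allowed,
as Mathlib's `OuterMeasure.mkMetric` allows empty sets, so finite covers are admissible. Only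
`s > 0` is meaningful (CKN use `s = 1`); for `s = 0`, `Real.rpow 0 0 = 1` makes `𝒫⁰` a
counting-type content. `∞` if there is no admissible cover (e.g. `δ ≤ 0`); in particular, for
`E` empty there are no cover centres `ℕ → ℝ × E` at all and `𝒫^s_δ X = ∞` for every `X`
(junk), so the outer-measure properties `parabolicHausdorff_empty` and
`parabolicHausdorff_le_mul_hausdorffMeasure` assume `[Nonempty E]`. [cite: CaffarelliKohnNirenberg1982, (2.6] -/
def parabolicHausdorffContent (s δ : ℝ) (X : Set (ℝ × E)) : ℝ≥0∞ :=
  ⨅ (z : ℕ → ℝ × E) (r : ℕ → ℝ) (_ : ∀ i, 0 ≤ r i ∧ r i < δ)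
    (_ : X ⊆ ⋃ i, parabolicCylinderCentered (r i) (z i)), ∑' i, ENNReal.ofReal (r i ^ s)

/-- The **parabolic Hausdorff measure** `𝒫^s(X) = lim_{δ → 0⁺} 𝒫^s_δ(X) = sup_{δ > 0} 𝒫^s_δ(X)`
of `X ⊆ ℝ × E` (Caffarelli–Kohn–Nirenberg 1982, (2.6); an outer measure for `E` nonempty and
`s > 0`, cf. `parabolicHausdorff_mono`, `parabolicHausdorff_iUnion_le`,
`parabolicHausdorff_empty`). For `E` empty, `𝒫^s X = ∞` for every `X` (junk, see
`parabolicHausdorffContent`). [cite: CaffarelliKohnNirenberg1982, (2.6] -/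
def parabolicHausdorff (s : ℝ) (X : Set (ℝ × E)) : ℝ≥0∞ :=
  ⨆ (δ : ℝ) (_ : 0 < δ), parabolicHausdorffContent s δ X

/-- `X ⊆ ℝ × E` is **`𝒫^s`-null**, `𝒫^s(X) = 0` (Caffarelli–Kohn–Nirenberg 1982, Theorem B:
`𝒫¹(S) = 0` for the singular set `S`). [cite: CaffarelliKohnNirenberg1982, Theorem B:  𝒫¹(S] -/
def IsParabolicNull (s : ℝ) (X : Set (ℝ × E)) : Prop :=
  parabolicHausdorff s X = 0

/-- The `δ`-content is monotone in the set (covers of `Y` cover `X ⊆ Y`). [folklore] -/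
theorem parabolicHausdorffContent_mono (s δ : ℝ) {X Y : Set (ℝ × E)} (h : X ⊆ Y) :
    parabolicHausdorffContent s δ X ≤ parabolicHausdorffContent s δ Y :=
  iInf_mono fun _ => iInf_mono fun _ => iInf_mono fun _ =>
    iInf_mono' fun hY => ⟨h.trans hY, le_rfl⟩

/-- The `δ`-content is antitone in `δ` (more covers are admissible for larger `δ`). [folklore] -/
theorem parabolicHausdorffContent_anti (s : ℝ) {δ δ' : ℝ} (h : δ ≤ δ') (X : Set (ℝ × E)) :
    parabolicHausdorffContent s δ' X ≤ parabolicHausdorffContent s δ X :=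
  iInf_mono fun _ => iInf_mono fun _ =>
    iInf_mono' fun hr => ⟨fun i => ⟨(hr i).1, (hr i).2.trans_le h⟩, le_rfl⟩

/-- **Monotonicity** of the parabolic Hausdorff measure (CKN 1982, (2.6): `𝒫^s` is an outer
measure). [cite: CKN1982, (2.6] -/
theorem parabolicHausdorff_mono (s : ℝ) {X Y : Set (ℝ × E)} (h : X ⊆ Y) :
    parabolicHausdorff s X ≤ parabolicHausdorff s Y :=
  iSup₂_mono fun _ _ => parabolicHausdorffContent_mono _ _ h

/-- The parabolic Hausdorff measure of the empty set vanishes, for `s > 0` (cover by cylinders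
of radius `0`; CKN 1982, (2.6)). For `s = 0` this fails (`0 ^ 0 = 1`), see the docstring of
`parabolicHausdorffContent`. [cite: CKN1982, (2.6] -/
theorem parabolicHausdorff_empty [Nonempty E] {s : ℝ} (hs : 0 < s) :
    parabolicHausdorff s (∅ : Set (ℝ × E)) = 0 := by
  refine le_antisymm (iSup₂_le fun δ hδ => ?_) (zero_le)
  obtain ⟨x⟩ := ‹Nonempty E›
  refine iInf_le_of_le (fun _ => (0, x)) <| iInf_le_of_le (fun _ => 0) <|
    iInf_le_of_le (fun _ => ⟨le_rfl, hδ⟩) <| iInf_le_of_le (empty_subset _) ?_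
  simp [Real.zero_rpow hs.ne']

/-- **Countable subadditivity** of the parabolic Hausdorff measure (CKN 1982, (2.6): `𝒫^s` is
an outer measure; concatenate `ε 2⁻ⁱ`-optimal covers). [cite: CKN1982, (2.6] -/
def parabolicHausdorff_iUnion_le : Prop :=
  ∀ (s : ℝ) (X : ℕ → Set (ℝ × E)),
    parabolicHausdorff s (⋃ i, X i) ≤ ∑' i, parabolicHausdorff s (X i)

/-- Finite subadditivity (interleave covers of `X` and `Y`; CKN 1982, (2.6)). [cite: CKN1982, (2.6] -/
def parabolicHausdorff_union_le : Prop :=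
  ∀ (s : ℝ) (X Y : Set (ℝ × E)),
    parabolicHausdorff s (X ∪ Y) ≤ parabolicHausdorff s X + parabolicHausdorff s Y

/-- A `𝒫^s`-null set has `𝒫^s`-null subsets (monotonicity). [folklore] -/
theorem IsParabolicNull.mono {s : ℝ} {X Y : Set (ℝ × E)} (hY : IsParabolicNull s Y)
    (h : X ⊆ Y) : IsParabolicNull s X :=
  le_antisymm ((parabolicHausdorff_mono s h).trans_eq hY) (zero_le)

end Hausdorff

section HausdorffComparison

variable {E : Type*} [MetricSpace E] [SecondCountableTopology E] [MeasurableSpace E]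
  [BorelSpace E]

/-- **Comparison with the Hausdorff measure**: on `ℝ × E` with the (sup) product metric, every
centred parabolic cylinder `Q*_r(z)` with `r < 1` has diameter `≤ 2r`, whence
`μH[s](X) ≤ 2^s 𝒫^s(X)`; in particular `𝒫^s`-null sets are `μH[s]`-null
(Caffarelli–Kohn–Nirenberg 1982, §2 after (2.6): "`𝒫¹(X) = 0` implies that `X` has Hausdorff
dimension at most `1`"). [cite: CaffarelliKohnNirenberg1982, §2 after (2.6] -/
def hausdorffMeasure_le_mul_parabolicHausdorff : Prop :=
  ∀ {s : ℝ} (hs : 0 < s) (X : Set (ℝ × E)),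
    μH[s] X ≤ 2 ^ s * parabolicHausdorff s X

/-- **Converse comparison**: a set of (sup-metric) diameter `d < 1` containing `z` lies in the
centred cylinder `Q*_{2√d}(z)`, of cost `2^s d^{s/2}`, whence `𝒫^s(X) ≤ 2^s μH[s/2](X)`; so
`𝒫^s` is squeezed between the Hausdorff measures of dimensions `s` and `s/2` of the product
metric (CKN 1982, §2, discussion of (2.6)). Requires `[Nonempty E]`: for `E` empty the left-hand
side is the junk value `∞` while `μH[s/2] ∅ = 0`. [cite: CKN1982, §2  discussion of (2.6] -/
def parabolicHausdorff_le_mul_hausdorffMeasure : Prop :=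
  ∀ [Nonempty E] {s : ℝ} (hs : 0 < s) (X : Set (ℝ × E)),
    parabolicHausdorff s X ≤ 2 ^ s * μH[s / 2] X

/-- `𝒫^s`-null sets are `μH[s]`-null (CKN 1982, §2, remark after (2.6)). [cite: CKN1982, §2  remark after (2.6] -/
def IsParabolicNull.hausdorffMeasure_eq_zero : Prop :=
  ∀ {s : ℝ} (hs : 0 < s) {X : Set (ℝ × E)} (hX : IsParabolicNull s X),
    μH[s] X = 0

/- interim proof relied on results that are now named facts (D-0014); demoted to a fact by the M5 import, proof preserved:
:= by
  refine le_antisymm ((hausdorffMeasure_le_mul_parabolicHausdorff hs X).trans ?_) zero_le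
  rw [hX, mul_zero]
-/

end HausdorffComparison

end Literature.Analysis.FluidPDE
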